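import Literature.Computability.AlgebraicComplexity.DIP20MonomialCounts
import Literature.Computability.AlgebraicComplexity.DIP20PlethysmCountingFormulaProofs
import Literature.Computability.AlgebraicComplexity.DIP20ToyModelOccurrenceObstructions
import HarnessLib

/-!
# Dörfler–Ikenmeyer–Panova 2019: the printed plethysm values `a_{(n²-2,n,2)}((n+1)[n])`,
# `a_{(n²-2,n,2)}(n[n+1])` for `2 ≤ n ≤ 7`, PROVED in the kernel, and what they discharge

Topic `Literature/Computability/AlgebraicComplexity`; sibling proofs file (D-0014) of
`DIP20MultiplicityObstructions.lean` (named facts `DIP20_prop_3_2`, `DIP20_thm_2_3_2a/2b`,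
`DIP20_thm_3_5`, `DIP20_prop_3_15`, `DIP20_prop_3_15_table`). No new facts, no new definitions.

J. Dörfler, C. Ikenmeyer, G. Panova, SIAM J. Appl. Algebra Geom. 4 (2020) = arXiv:1901.04576. The paper's
plethysm coefficients "were performed with the LiE software" (Prop. 3.2, arXiv p. 4; Prop. 3.15, p. 8).
Here the twelve values of the family `λ = (n²-2, n, 2)`, `2 ≤ n ≤ 7`,

| `n` | `λ` | `a_λ((n+1)[n])` | `a_λ(n[n+1])` | printed where |
|---|---|---|---|---|
| 2 | `(2,2,2)`  | 1  | 0  | Prop. 3.15, table row 1 (p. 8) |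
| 3 | `(7,3,2)`  | 1  | 0  | Prop. 3.15, table row 2 |
| 4 | `(14,4,2)` | 3  | 2  | (instance of Thm. 3.5) |
| 5 | `(23,5,2)` | 4  | 3  | (instance of Thm. 3.5) |
| 6 | `(34,6,2)` | 8  | 7  | Prop. 3.2 "`= 8 = a_{(34,6,2)}(7[6])`"; Thm. 2.3 (2)(a) "`= 7 <`" |
| 7 | `(47,7,2)` | 11 | 10 | Prop. 3.2 "`= 11 = a_{(47,7,2)}(8[7])`"; Thm. 2.3 (2)(b) "`< 11`" |

are THEOREMS: each is the printed counting formula (4.4) (`a_λ(d[n]) = Σ_{π ∈ 𝔖₃} sgn(π)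
c_{λ+π-id}(d,n)`, tree `DIP20_eq_4_4_holds`, sibling `DIP20PlethysmCountingFormulaProofs.lean`) with
the six monomial counts `c_ν(d,n)` of (4.3) evaluated by the kernel through the list evaluator
`dipMonomialCount_eq_L` (sibling `DIP20MonomialCounts.lean`); `decide +kernel`, no `native_decide`,
≤ 10⁴ search nodes per value.

**What they discharge** (all `[cite]`d to the printed statement they instantiate):

* the two plethysm conjuncts of Prop. 3.2 (`plethysmCoeffOfPartition_dipPartition_six/_seven`), so that
  `DIP20_prop_3_2` reduces to the two LOWER bounds `8 ≤ mult_{(34,6,2)}(ℂ[Pow_{3,4}^6]_7)`,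
  `11 ≤ mult_{(47,7,2)}(ℂ[Pow_{3,4}^7]_8)` of its tableau certificate (`DIP20_prop_3_2_of_lower_bounds`;
  the upper bounds are `mult ≤ a`, `coordRingMultiplicity_le_plethysmCoeff`);
* Thm. 3.5 for `2 ≤ n ≤ 7` (`DIP20_thm_3_5_of_le_seven`);
* the Chow sides of Thm. 2.3 (2): `mult_{(34,6,2)}(ℂ[Ch_3^6]_7) ≤ 7` and `mult_{(47,7,2)}(ℂ[Ch_4^7]_8) ≤ 10 < 11`
  UNCONDITIONALLY (Lemma 3.4, tree `DIP20_lem_3_4_holds`, with `a_λ(6[7]) = 7`, `a_λ(7[8]) = 10` — the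
  printed road "`mult_λ(ℂ[Ch_m^n]_d) ≤ a_λ(n[d])`", arXiv p. 5), whence `DIP20_thm_2_3_2b` from the
  power-sum value and Props. 7.1, 5.1 only (`DIP20_thm_2_3_2b_of_values`), and `DIP20_thm_2_3_2a` from the
  lower bound `7 ≤ mult_{(34,6,2)}(ℂ[Ch_3^6]_7)`, the power-sum value and Props. 3.9, 5.1
  (`DIP20_thm_2_3_2a_of_values`);
* rows 1–2 of Prop. 3.15 unconditionally (`DIP20_prop_3_15_row1/row2`) and of its table
  (`DIP20_prop_3_15_table_row1/row2`); Prop. 3.15 from the five remaining entries of rows 3–5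
  (`DIP20_prop_3_15_of_rows345`).

Not covered (size, recorded in the typing session): the table rows 3–5 (`(11,9,8)`, `(12,9,9)`,
`(14,14,13,13)`) — `1.4·10⁵` to `10¹⁰` search nodes per value, beyond one kernel evaluation.

HONEST FRAMING: finite plethysm arithmetic of the toy model `Pow ⊄ Ch`; nothing here bears on permanent
versus determinant; VP ≠ VNP is not proved.

## References

* J. Dörfler, C. Ikenmeyer, G. Panova, SIAM J. Appl. Algebra Geom. 4 (2020) = arXiv:1901.04576,
  Thm. 2.3 (2), Prop. 3.2, Lemma 3.4, Thm. 3.5, Prop. 3.15, eqs. (4.3)–(4.4)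
  (TeX `multobs.tex` L280 `{thm:main}`, L324 `{pro:smallcomputercalc}`, L339 `{lem:chowupperbound}`,
  L378 `{thm:plethineq}`, L513 `{pro:occobsdoexist}`). [DorflerIkenmeyerPanova2020]

## Mathlib and tree

Tree: `DIP20_eq_4_4_holds` (`DIP20PlethysmCountingFormulaProofs`), `dipMonomialCount_eq_L`
(`DIP20MonomialCounts`), `DIP20_lem_3_4_holds` (`DIP20ChowUpperBoundProofs`),
`coordRingMultiplicity_chowSet_three_two_222`, `coordRingMultiplicity_chowSet_eq_zero_of_lem_3_4`,
`DIP20_prop_3_15_of_plethysm_bounds` (`DIP20ToyModelOccurrenceObstructions`), `rowDual_dipFamilyRow_self`,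
`plethysmCoeffOfPartition_eq_of_card_parts_le`, `coordRingMultiplicity_le_plethysmCoeff`,
`coordRingMultiplicity_powerSumSet_eq_plethysmCoeff`, `coordRingMultiplicity_powerSumSet_dualOfPartition_eq_of_le`,
`dip20_eq_3_6_of_prop_3_9_of_prop_5_1`, `dip20_noOccurrence47_of_prop_7_1_of_prop_5_1`
(`DIP20MultiplicityObstructions`).

Provenance: val-lit cell, typer val-lit-t07 g2 (DAG row DIP2020-A, discharge pass).
-/

noncomputable section

namespace Literature.Computability.AlgebraicComplexity

open _root_.Literature.NumberTheory.DiophantineGeometry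

/-! ### §V0. The evaluation pattern: (4.4) with the list evaluator of (4.3) -/

section Evaluation

/-- A weakly decreasing triple is antitone. [cite: DorflerIkenmeyerPanova2020, §2 (arXiv p. 3: `m`-partitions)] -/
private theorem antitone_fin3' {μ : Fin 3 → ℕ} (h10 : μ 1 ≤ μ 0) (h21 : μ 2 ≤ μ 1) : Antitone μ := by
  intro i j hij
  fin_cases i <;> fin_cases j <;> simp at hij ⊢ <;> omega

/-- **(4.4) in evaluable form for three rows**: for a `3`-partition `μ` of `dn` (`n ≥ 1`),
`a_μ(d[n]) = Σ_{π ∈ 𝔖₃} sgn(π) c_{μ+π-id}(d,n)` with each `c_ν(d,n)` the list evaluator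
`dipMonomialCountL` (kernel-reducible). [cite: DorflerIkenmeyerPanova2020, eqs. (4.3)–(4.4) (arXiv p. 9)] -/
theorem plethysmCoeff_fin_three_cast_eq_sum_dipMonomialCountL (μ : Fin 3 → ℕ) {n d : ℕ} (hn : 0 < n)
    (h10 : μ 1 ≤ μ 0) (h21 : μ 2 ≤ μ 1) (hsum : ∑ i, μ i = d * n) :
    (plethysmCoeff ℂ (Fin 3) n (rowDual μ) : ℤ) =
      ∑ π : Equiv.Perm (Fin 3), ((Equiv.Perm.sign π : ℤˣ) : ℤ) *
        (if ∀ i : Fin 3, (i : ℕ) ≤ μ i + (π i : ℕ)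
          then (dipMonomialCountL (fun i : Fin 3 => μ i + (π i : ℕ) - (i : ℕ)) d n : ℤ) else 0) := by
  have h := DIP20_eq_4_4_holds 3 n d μ hn (antitone_fin3' h10 h21) hsum
  simpa only [dipMonomialCount_eq_L] using h

end Evaluation

/-! ### §V1. The twelve values `a_{(n²-2,n,2)}((n+1)[n])`, `a_{(n²-2,n,2)}(n[n+1])`, `2 ≤ n ≤ 7` -/

section Values

/-- `a_{(2,2,2)}(3[2]) = 1` (Prop. 3.15, table row 1, column `a_λ(d[n])`).
[cite: DorflerIkenmeyerPanova2020, Prop. 3.15 (table row 1, arXiv p. 8; TeX multobs.tex L513 {pro:occobsdoexist})] -/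
theorem plethysmCoeff_rowDual_2_2_2_two : plethysmCoeff ℂ (Fin 3) 2 (rowDual ![2, 2, 2]) = 1 := by
  have h := plethysmCoeff_fin_three_cast_eq_sum_dipMonomialCountL ![2, 2, 2] (n := 2) (d := 3)
    (by norm_num) (by simp) (by simp) (by simp [Fin.sum_univ_three])
  have h2 : (plethysmCoeff ℂ (Fin 3) 2 (rowDual ![2, 2, 2]) : ℤ) = 1 := by
    rw [h]
    decide +kernel
  exact_mod_cast h2

/-- `a_{(2,2,2)}(2[3]) = 0` (Prop. 3.15, table row 1, column `a_λ(n[d])`).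
[cite: DorflerIkenmeyerPanova2020, Prop. 3.15 (table row 1, arXiv p. 8; TeX multobs.tex L513 {pro:occobsdoexist})] -/
theorem plethysmCoeff_rowDual_2_2_2_three : plethysmCoeff ℂ (Fin 3) 3 (rowDual ![2, 2, 2]) = 0 := by
  have h := plethysmCoeff_fin_three_cast_eq_sum_dipMonomialCountL ![2, 2, 2] (n := 3) (d := 2)
    (by norm_num) (by simp) (by simp) (by simp [Fin.sum_univ_three])
  have h2 : (plethysmCoeff ℂ (Fin 3) 3 (rowDual ![2, 2, 2]) : ℤ) = 0 := by
    rw [h]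
    decide +kernel
  exact_mod_cast h2

/-- `a_{(7,3,2)}(4[3]) = 1` (Prop. 3.15, table row 2, column `a_λ(d[n])`).
[cite: DorflerIkenmeyerPanova2020, Prop. 3.15 (table row 2, arXiv p. 8; TeX multobs.tex L513 {pro:occobsdoexist})] -/
theorem plethysmCoeff_rowDual_7_3_2_three : plethysmCoeff ℂ (Fin 3) 3 (rowDual ![7, 3, 2]) = 1 := by
  have h := plethysmCoeff_fin_three_cast_eq_sum_dipMonomialCountL ![7, 3, 2] (n := 3) (d := 4)
    (by norm_num) (by simp) (by simp) (by simp [Fin.sum_univ_three])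
  have h2 : (plethysmCoeff ℂ (Fin 3) 3 (rowDual ![7, 3, 2]) : ℤ) = 1 := by
    rw [h]
    decide +kernel
  exact_mod_cast h2

/-- `a_{(7,3,2)}(3[4]) = 0` (Prop. 3.15, table row 2, column `a_λ(n[d])`).
[cite: DorflerIkenmeyerPanova2020, Prop. 3.15 (table row 2, arXiv p. 8; TeX multobs.tex L513 {pro:occobsdoexist})] -/
theorem plethysmCoeff_rowDual_7_3_2_four : plethysmCoeff ℂ (Fin 3) 4 (rowDual ![7, 3, 2]) = 0 := by
  have h := plethysmCoeff_fin_three_cast_eq_sum_dipMonomialCountL ![7, 3, 2] (n := 4) (d := 3)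
    (by norm_num) (by simp) (by simp) (by simp [Fin.sum_univ_three])
  have h2 : (plethysmCoeff ℂ (Fin 3) 4 (rowDual ![7, 3, 2]) : ℤ) = 0 := by
    rw [h]
    decide +kernel
  exact_mod_cast h2

/-- `a_{(14,4,2)}(5[4]) = 3` (the `n = 4` instance of the left side of Thm. 3.5).
[cite: DorflerIkenmeyerPanova2020, Thm. 3.5 (arXiv p. 5; TeX multobs.tex L378 {thm:plethineq}) with eq. (4.4)] -/
theorem plethysmCoeff_rowDual_14_4_2_four : plethysmCoeff ℂ (Fin 3) 4 (rowDual ![14, 4, 2]) = 3 := by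
  have h := plethysmCoeff_fin_three_cast_eq_sum_dipMonomialCountL ![14, 4, 2] (n := 4) (d := 5)
    (by norm_num) (by simp) (by simp) (by simp [Fin.sum_univ_three])
  have h2 : (plethysmCoeff ℂ (Fin 3) 4 (rowDual ![14, 4, 2]) : ℤ) = 3 := by
    rw [h]
    decide +kernel
  exact_mod_cast h2

/-- `a_{(14,4,2)}(4[5]) = 2` (the `n = 4` instance of the right side of Thm. 3.5).
[cite: DorflerIkenmeyerPanova2020, Thm. 3.5 (arXiv p. 5; TeX multobs.tex L378 {thm:plethineq}) with eq. (4.4)] -/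
theorem plethysmCoeff_rowDual_14_4_2_five : plethysmCoeff ℂ (Fin 3) 5 (rowDual ![14, 4, 2]) = 2 := by
  have h := plethysmCoeff_fin_three_cast_eq_sum_dipMonomialCountL ![14, 4, 2] (n := 5) (d := 4)
    (by norm_num) (by simp) (by simp) (by simp [Fin.sum_univ_three])
  have h2 : (plethysmCoeff ℂ (Fin 3) 5 (rowDual ![14, 4, 2]) : ℤ) = 2 := by
    rw [h]
    decide +kernel
  exact_mod_cast h2

/-- `a_{(23,5,2)}(6[5]) = 4` (the `n = 5` instance of the left side of Thm. 3.5).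
[cite: DorflerIkenmeyerPanova2020, Thm. 3.5 (arXiv p. 5; TeX multobs.tex L378 {thm:plethineq}) with eq. (4.4)] -/
theorem plethysmCoeff_rowDual_23_5_2_five : plethysmCoeff ℂ (Fin 3) 5 (rowDual ![23, 5, 2]) = 4 := by
  have h := plethysmCoeff_fin_three_cast_eq_sum_dipMonomialCountL ![23, 5, 2] (n := 5) (d := 6)
    (by norm_num) (by simp) (by simp) (by simp [Fin.sum_univ_three])
  have h2 : (plethysmCoeff ℂ (Fin 3) 5 (rowDual ![23, 5, 2]) : ℤ) = 4 := by
    rw [h]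
    decide +kernel
  exact_mod_cast h2

/-- `a_{(23,5,2)}(5[6]) = 3` (the `n = 5` instance of the right side of Thm. 3.5).
[cite: DorflerIkenmeyerPanova2020, Thm. 3.5 (arXiv p. 5; TeX multobs.tex L378 {thm:plethineq}) with eq. (4.4)] -/
theorem plethysmCoeff_rowDual_23_5_2_six : plethysmCoeff ℂ (Fin 3) 6 (rowDual ![23, 5, 2]) = 3 := by
  have h := plethysmCoeff_fin_three_cast_eq_sum_dipMonomialCountL ![23, 5, 2] (n := 6) (d := 5)
    (by norm_num) (by simp) (by simp) (by simp [Fin.sum_univ_three])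
  have h2 : (plethysmCoeff ℂ (Fin 3) 6 (rowDual ![23, 5, 2]) : ℤ) = 3 := by
    rw [h]
    decide +kernel
  exact_mod_cast h2

set_option maxHeartbeats 1000000 in
/-- **`a_{(34,6,2)}(7[6]) = 8`** (Prop. 3.2: "`mult_{(34,6,2)}(ℂ[Pow_{3,4}^6]_7) = 8 = a_{(34,6,2)}(7[6])`",
the plethysm value, printed as a LiE computation).
[cite: DorflerIkenmeyerPanova2020, Prop. 3.2 (arXiv p. 4; TeX multobs.tex L324 {pro:smallcomputercalc}) with eq. (4.4)] -/
theorem plethysmCoeff_rowDual_34_6_2_six : plethysmCoeff ℂ (Fin 3) 6 (rowDual ![34, 6, 2]) = 8 := by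
  have h := plethysmCoeff_fin_three_cast_eq_sum_dipMonomialCountL ![34, 6, 2] (n := 6) (d := 7)
    (by norm_num) (by simp) (by simp) (by simp [Fin.sum_univ_three])
  have h2 : (plethysmCoeff ℂ (Fin 3) 6 (rowDual ![34, 6, 2]) : ℤ) = 8 := by
    rw [h]
    decide +kernel
  exact_mod_cast h2

set_option maxHeartbeats 1000000 in
/-- **`a_{(34,6,2)}(6[7]) = 7`** (the `n = 6` instance of Thm. 3.5, `8 = 1 + 7`; the bound
"`mult_λ(ℂ[Ch_3^6]_7) ≤ a_λ(6[7])`" of Lemma 3.4 behind Thm. 2.3 (2)(a)'s "`= 7`").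
[cite: DorflerIkenmeyerPanova2020, Thm. 3.5 (arXiv p. 5; TeX multobs.tex L378 {thm:plethineq}) and Thm. 2.3 (2)(a) (arXiv p. 4) with eq. (4.4)] -/
theorem plethysmCoeff_rowDual_34_6_2_seven : plethysmCoeff ℂ (Fin 3) 7 (rowDual ![34, 6, 2]) = 7 := by
  have h := plethysmCoeff_fin_three_cast_eq_sum_dipMonomialCountL ![34, 6, 2] (n := 7) (d := 6)
    (by norm_num) (by simp) (by simp) (by simp [Fin.sum_univ_three])
  have h2 : (plethysmCoeff ℂ (Fin 3) 7 (rowDual ![34, 6, 2]) : ℤ) = 7 := by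
    rw [h]
    decide +kernel
  exact_mod_cast h2

set_option maxHeartbeats 1000000 in
/-- **`a_{(47,7,2)}(8[7]) = 11`** (Prop. 3.2: "`mult_{(47,7,2)}(ℂ[Pow_{3,4}^7]_8) = 11 = a_{(47,7,2)}(8[7])`",
the plethysm value, printed as a LiE computation).
[cite: DorflerIkenmeyerPanova2020, Prop. 3.2 (arXiv p. 4; TeX multobs.tex L324 {pro:smallcomputercalc}) with eq. (4.4)] -/
theorem plethysmCoeff_rowDual_47_7_2_seven : plethysmCoeff ℂ (Fin 3) 7 (rowDual ![47, 7, 2]) = 11 := by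
  have h := plethysmCoeff_fin_three_cast_eq_sum_dipMonomialCountL ![47, 7, 2] (n := 7) (d := 8)
    (by norm_num) (by simp) (by simp) (by simp [Fin.sum_univ_three])
  have h2 : (plethysmCoeff ℂ (Fin 3) 7 (rowDual ![47, 7, 2]) : ℤ) = 11 := by
    rw [h]
    decide +kernel
  exact_mod_cast h2

set_option maxHeartbeats 1000000 in
/-- **`a_{(47,7,2)}(7[8]) = 10`** (the `n = 7` instance of Thm. 3.5, `11 = 1 + 10`; the bound
"`mult_λ(ℂ[Ch_4^7]_8) ≤ a_λ(7[8])`" of Lemma 3.4 behind Thm. 2.3 (2)(b)'s "`< 11`").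
[cite: DorflerIkenmeyerPanova2020, Thm. 3.5 (arXiv p. 5; TeX multobs.tex L378 {thm:plethineq}) and Thm. 2.3 (2)(b) (arXiv p. 4) with eq. (4.4)] -/
theorem plethysmCoeff_rowDual_47_7_2_eight : plethysmCoeff ℂ (Fin 3) 8 (rowDual ![47, 7, 2]) = 10 := by
  have h := plethysmCoeff_fin_three_cast_eq_sum_dipMonomialCountL ![47, 7, 2] (n := 8) (d := 7)
    (by norm_num) (by simp) (by simp) (by simp [Fin.sum_univ_three])
  have h2 : (plethysmCoeff ℂ (Fin 3) 8 (rowDual ![47, 7, 2]) : ℤ) = 10 := by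
    rw [h]
    decide +kernel
  exact_mod_cast h2

end Values

/-! ### §V2. Partition forms: Prop. 3.2's plethysm conjuncts and Thm. 3.5 for `2 ≤ n ≤ 7` -/

section PartitionForms

/-- `a_λ` of `λ = (n²-2,n,2)` in partition form is the weight form on the row vector `(n²-2, n, 2)`.
[cite: DorflerIkenmeyerPanova2020, §2 (arXiv p. 3: `λ^*`, `m`-partitions as weights)] -/
theorem plethysmCoeffOfPartition_dipPartition_eq {n : ℕ} (hn : 2 ≤ n) (d : ℕ) :
    plethysmCoeffOfPartition ℂ 3 d (dipPartition n hn) =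
      plethysmCoeff ℂ (Fin 3) d (rowDual ![n ^ 2 - 2, n, 2]) := by
  unfold plethysmCoeffOfPartition
  rw [rowDual_dipFamilyRow_self hn]

/-- **Prop. 3.2, first plethysm value**: `a_{(34,6,2)}(7[6]) = 8`, partition form (the second conjunct
of `DIP20_prop_3_2`). [cite: DorflerIkenmeyerPanova2020, Prop. 3.2 (arXiv p. 4; TeX multobs.tex L324 {pro:smallcomputercalc})] -/
theorem plethysmCoeffOfPartition_dipPartition_six (h : 2 ≤ 6) :
    plethysmCoeffOfPartition ℂ 3 6 (dipPartition 6 h) = 8 := by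
  rw [plethysmCoeffOfPartition_dipPartition_eq, show (6 : ℕ) ^ 2 - 2 = 34 by norm_num]
  exact plethysmCoeff_rowDual_34_6_2_six

/-- `a_{(34,6,2)}(6[7]) = 7`, partition form. [cite: DorflerIkenmeyerPanova2020, Thm. 3.5 at `n = 6` (arXiv p. 5) with Prop. 3.2] -/
theorem plethysmCoeffOfPartition_dipPartition_six_succ (h : 2 ≤ 6) :
    plethysmCoeffOfPartition ℂ 3 7 (dipPartition 6 h) = 7 := by
  rw [plethysmCoeffOfPartition_dipPartition_eq, show (6 : ℕ) ^ 2 - 2 = 34 by norm_num]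
  exact plethysmCoeff_rowDual_34_6_2_seven

/-- **Prop. 3.2, second plethysm value**: `a_{(47,7,2)}(8[7]) = 11`, partition form (the fourth
conjunct of `DIP20_prop_3_2`). [cite: DorflerIkenmeyerPanova2020, Prop. 3.2 (arXiv p. 4; TeX multobs.tex L324 {pro:smallcomputercalc})] -/
theorem plethysmCoeffOfPartition_dipPartition_seven (h : 2 ≤ 7) :
    plethysmCoeffOfPartition ℂ 3 7 (dipPartition 7 h) = 11 := by
  rw [plethysmCoeffOfPartition_dipPartition_eq, show (7 : ℕ) ^ 2 - 2 = 47 by norm_num]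
  exact plethysmCoeff_rowDual_47_7_2_seven

/-- `a_{(47,7,2)}(7[8]) = 10`, partition form. [cite: DorflerIkenmeyerPanova2020, Thm. 3.5 at `n = 7` (arXiv p. 5) with Prop. 3.2] -/
theorem plethysmCoeffOfPartition_dipPartition_seven_succ (h : 2 ≤ 7) :
    plethysmCoeffOfPartition ℂ 3 8 (dipPartition 7 h) = 10 := by
  rw [plethysmCoeffOfPartition_dipPartition_eq, show (7 : ℕ) ^ 2 - 2 = 47 by norm_num]
  exact plethysmCoeff_rowDual_47_7_2_eight

/-- **Thm. 3.5 for `2 ≤ n ≤ 7`**: "`a_{(n²-2,n,2)}((n+1)[n]) = 1 + a_{(n²-2,n,2)}(n[n+1])`", by the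
twelve values above (`1 = 1+0`, `1 = 1+0`, `3 = 1+2`, `4 = 1+3`, `8 = 1+7`, `11 = 1+10`).
[cite: DorflerIkenmeyerPanova2020, Thm. 3.5 (arXiv p. 5; TeX multobs.tex L378 {thm:plethineq})] -/
theorem DIP20_thm_3_5_of_le_seven (n : ℕ) (hn : 2 ≤ n) (hn7 : n ≤ 7) :
    plethysmCoeffOfPartition ℂ 3 n (dipPartition n hn) =
      1 + plethysmCoeffOfPartition ℂ 3 (n + 1) (dipPartition n hn) := by
  rw [plethysmCoeffOfPartition_dipPartition_eq, plethysmCoeffOfPartition_dipPartition_eq]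
  obtain rfl | rfl | rfl | rfl | rfl | rfl : n = 2 ∨ n = 3 ∨ n = 4 ∨ n = 5 ∨ n = 6 ∨ n = 7 := by omega
  · rw [show (2 : ℕ) ^ 2 - 2 = 2 by norm_num, plethysmCoeff_rowDual_2_2_2_two,
      plethysmCoeff_rowDual_2_2_2_three]
  · rw [show (3 : ℕ) ^ 2 - 2 = 7 by norm_num, plethysmCoeff_rowDual_7_3_2_three,
      plethysmCoeff_rowDual_7_3_2_four]
  · rw [show (4 : ℕ) ^ 2 - 2 = 14 by norm_num, plethysmCoeff_rowDual_14_4_2_four,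
      plethysmCoeff_rowDual_14_4_2_five]
  · rw [show (5 : ℕ) ^ 2 - 2 = 23 by norm_num, plethysmCoeff_rowDual_23_5_2_five,
      plethysmCoeff_rowDual_23_5_2_six]
  · rw [show (6 : ℕ) ^ 2 - 2 = 34 by norm_num, plethysmCoeff_rowDual_34_6_2_six,
      plethysmCoeff_rowDual_34_6_2_seven]
  · rw [show (7 : ℕ) ^ 2 - 2 = 47 by norm_num, plethysmCoeff_rowDual_47_7_2_seven,
      plethysmCoeff_rowDual_47_7_2_eight]

/-- **Prop. 3.2 reduced to its certificate's lower bounds**: the plethysm conjuncts are theorems and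
`mult_λ(ℂ[Pow]_d) ≤ a_λ` always (`coordRingMultiplicity_le_plethysmCoeff`), so the printed computer
calculation (§6: "8 tableaux … evaluated at 8 random points in `Pow_{3,4}^6` … non-singularity", resp.
11) enters only as `8 ≤ mult_{(34,6,2)}(ℂ[Pow_{3,4}^6]_7)` and `11 ≤ mult_{(47,7,2)}(ℂ[Pow_{3,4}^7]_8)`.
[cite: DorflerIkenmeyerPanova2020, Prop. 3.2 (arXiv p. 4) and its proof (§6, arXiv p. 15; TeX multobs.tex L880)] -/
theorem DIP20_prop_3_2_of_lower_bounds {h6 : 2 ≤ 6} {h7 : 2 ≤ 7}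
    (hle6 : 8 ≤ coordRingMultiplicity ℂ (powerSumSet ℂ 3 4 6) 6 (Weight.dualOfPartition 3 (dipPartition 6 h6)))
    (hle7 : 11 ≤ coordRingMultiplicity ℂ (powerSumSet ℂ 3 4 7) 7 (Weight.dualOfPartition 3 (dipPartition 7 h7))) :
    DIP20_prop_3_2 := by
  have hup6 := coordRingMultiplicity_le_plethysmCoeff (powerSumSet ℂ 3 4 6) 6
    (Weight.dualOfPartition 3 (dipPartition 6 h6))
  have hup7 := coordRingMultiplicity_le_plethysmCoeff (powerSumSet ℂ 3 4 7) 7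
    (Weight.dualOfPartition 3 (dipPartition 7 h7))
  have hv6 := plethysmCoeffOfPartition_dipPartition_six h6
  have hv7 := plethysmCoeffOfPartition_dipPartition_seven h7
  unfold plethysmCoeffOfPartition at hv6 hv7
  rw [hv6] at hup6
  rw [hv7] at hup7
  exact ⟨le_antisymm hup6 hle6, plethysmCoeffOfPartition_dipPartition_six h6, le_antisymm hup7 hle7,
    plethysmCoeffOfPartition_dipPartition_seven h7⟩

end PartitionForms

/-! ### §V3. Lemma 3.4 applied: the Chow sides of Thm. 2.3 (2) -/

section ChowSides

/-- **Thm. 2.3 (2)(a), Chow side, upper bound**: `mult_{(34,6,2)}(ℂ[Ch_3^6]_7) ≤ a_{(34,6,2)}(6[7]) = 7`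
(Lemma 3.4 "`mult_λ(ℂ[Ch_m^n]_d) ≤ a_λ(n[d])`" at `m = 3`, `n = 6`, `d = 7`, and the value). The
printed "`= 7`" also needs the lower bound of §5–§6, not derived here.
[cite: DorflerIkenmeyerPanova2020, Thm. 2.3 (2)(a) (arXiv p. 4) via Lemma 3.4 (p. 5) and Thm. 3.5] -/
theorem coordRingMultiplicity_chowSet_three_six_dipPartition_le (h : 2 ≤ 6) :
    coordRingMultiplicity ℂ (chowSet ℂ 3 6) 6 (Weight.dualOfPartition 3 (dipPartition 6 h)) ≤ 7 := by
  have h34 : coordRingMultiplicity ℂ (chowSet ℂ 3 6) 6 (Weight.dualOfPartition 3 (dipPartition 6 h)) ≤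
      plethysmCoeffOfPartition ℂ 3 7 (dipPartition 6 h) :=
    DIP20_lem_3_4_holds 3 6 _ (by norm_num) (by norm_num) (dipPartition 6 h) (card_parts_dipPartition_le 6 h)
  rwa [plethysmCoeffOfPartition_dipPartition_six_succ h] at h34

/-- **Thm. 2.3 (2)(b), Chow side, upper bound**: `mult_{(47,7,2)}(ℂ[Ch_4^7]_8) ≤ a_{(47,7,2)}(7[8]) = 10`
(Lemma 3.4 at `m = 4`, `n = 7`, `d = 8`; the value is computed for `GL_3`, the number of rows `≥ ℓ(λ) = 3`
being immaterial, `plethysmCoeffOfPartition_eq_of_card_parts_le`).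
[cite: DorflerIkenmeyerPanova2020, Thm. 2.3 (2)(b) (arXiv p. 4) via Lemma 3.4 (p. 5) and Thm. 3.5] -/
theorem coordRingMultiplicity_chowSet_four_seven_dipPartition_le (h : 2 ≤ 7) :
    coordRingMultiplicity ℂ (chowSet ℂ 4 7) 7 (Weight.dualOfPartition 4 (dipPartition 7 h)) ≤ 10 := by
  haveI : Infinite ℂ := CharZero.infinite ℂ
  have h34 : coordRingMultiplicity ℂ (chowSet ℂ 4 7) 7 (Weight.dualOfPartition 4 (dipPartition 7 h)) ≤
      plethysmCoeffOfPartition ℂ 4 8 (dipPartition 7 h) :=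
    DIP20_lem_3_4_holds 4 7 _ (by norm_num) (by norm_num) (dipPartition 7 h)
      ((card_parts_dipPartition_le 7 h).trans (by norm_num))
  have h4 := plethysmCoeffOfPartition_eq_of_card_parts_le (k := ℂ) (show 3 ≤ 4 by norm_num) 8
    (dipPartition 7 h) (card_parts_dipPartition_le 7 h)
  rw [h4, plethysmCoeffOfPartition_dipPartition_seven_succ h] at h34
  exact h34

/-- **Thm. 2.3 (2)(b), Chow side as printed**: "`mult_λ(ℂ[Ch_4^7]_8) < 11`" for `λ = (47,7,2)`,
unconditionally (first conjunct of `DIP20_thm_2_3_2b`). [cite: DorflerIkenmeyerPanova2020, Thm. 2.3 (2)(b) (arXiv p. 4; TeX multobs.tex L280 {thm:main})] -/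
theorem dip20_thm_2_3_2b_chow_lt (h : 2 ≤ 7) :
    coordRingMultiplicity ℂ (chowSet ℂ 4 7) 7 (Weight.dualOfPartition 4 (dipPartition 7 h)) < 11 :=
  lt_of_le_of_lt (coordRingMultiplicity_chowSet_four_seven_dipPartition_le h) (by norm_num)

/-- **Thm. 2.3 (2)(b) from the power-sum value and Props. 7.1, 5.1**: the Chow side is the theorem
above; the printed value `mult_{(47,7,2)}(ℂ[Pow_{3,4}^7]_8) = 11` (Prop. 3.2, three variables) is
transported to `Pow_{4,4}^7` by the power-sum inheritance; the no-occurrence clause from Props. 7.1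
and 5.1 (`dip20_noOccurrence47_of_prop_7_1_of_prop_5_1`).
[cite: DorflerIkenmeyerPanova2020, Thm. 2.3 (2)(b) (arXiv p. 4; proof §3, §5–§7)] -/
theorem DIP20_thm_2_3_2b_of_values {h : 2 ≤ 7}
    (hpow : coordRingMultiplicity ℂ (powerSumSet ℂ 3 4 7) 7 (Weight.dualOfPartition 3 (dipPartition 7 h)) = 11)
    (h71 : DIP20_prop_7_1) (h51 : DIP20_prop_5_1) : DIP20_thm_2_3_2b := by
  refine ⟨dip20_thm_2_3_2b_chow_lt _, ?_, dip20_noOccurrence47_of_prop_7_1_of_prop_5_1 h71 h51⟩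
  rw [← coordRingMultiplicity_powerSumSet_dualOfPartition_eq_of_le (show 3 ≤ 4 by norm_num)
    (by norm_num) (by norm_num) (dipPartition 7 h) (card_parts_dipPartition_le 7 h)]
  exact hpow

/-- **Thm. 2.3 (2)(b) from Props. 3.2, 7.1, 5.1** (the tree's `DIP20_thm_2_3_2b_of_facts'`, now with
the Chow side unconditional). [cite: DorflerIkenmeyerPanova2020, Thm. 2.3 (2)(b) (arXiv p. 4; proof §3, §5–§7)] -/
theorem DIP20_thm_2_3_2b_of_prop_3_2 (h32 : DIP20_prop_3_2) (h71 : DIP20_prop_7_1)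
    (h51 : DIP20_prop_5_1) : DIP20_thm_2_3_2b :=
  DIP20_thm_2_3_2b_of_values h32.2.2.1 h71 h51

/-- **Thm. 2.3 (2)(a) from the lower bound `7 ≤ mult_{(34,6,2)}(ℂ[Ch_3^6]_7)`, the power-sum value and
Props. 3.9, 5.1**: the upper bound `≤ 7` is the theorem above (Lemma 3.4 and `a_{(34,6,2)}(6[7]) = 7`).
[cite: DorflerIkenmeyerPanova2020, Thm. 2.3 (2)(a) (arXiv p. 4; proof §3, §5–§6)] -/
theorem DIP20_thm_2_3_2a_of_values {h : 2 ≤ 6}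
    (hlow : 7 ≤ coordRingMultiplicity ℂ (chowSet ℂ 3 6) 6 (Weight.dualOfPartition 3 (dipPartition 6 h)))
    (hpow : coordRingMultiplicity ℂ (powerSumSet ℂ 3 4 6) 6 (Weight.dualOfPartition 3 (dipPartition 6 h)) = 8)
    (h39 : DIP20_prop_3_9) (h51 : DIP20_prop_5_1) : DIP20_thm_2_3_2a :=
  ⟨le_antisymm (coordRingMultiplicity_chowSet_three_six_dipPartition_le _) hlow, hpow,
    dip20_eq_3_6_of_prop_3_9_of_prop_5_1 h39 h51⟩

end ChowSides

/-! ### §V4. Prop. 3.15, rows 1–2 unconditionally -/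

section Prop315Rows

/-- **Prop. 3.15, table row 1** (`m = 3`, `n = 2`, `λ = (2,2,2)`, `d = 3`): `a_λ(3[2]) = 1`,
`a_λ(2[3]) = 0` (the first conjunct of `DIP20_prop_3_15_table`).
[cite: DorflerIkenmeyerPanova2020, Prop. 3.15 (table row 1, arXiv p. 8; TeX multobs.tex L513 {pro:occobsdoexist})] -/
theorem DIP20_prop_3_15_table_row1 :
    plethysmCoeff ℂ (Fin 3) 2 (rowDual ![2, 2, 2]) = 1 ∧ plethysmCoeff ℂ (Fin 3) 3 (rowDual ![2, 2, 2]) = 0 :=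
  ⟨plethysmCoeff_rowDual_2_2_2_two, plethysmCoeff_rowDual_2_2_2_three⟩

/-- **Prop. 3.15, table row 2** (`m = 3`, `n = 3`, `λ = (7,3,2)`, `d = 4`): `a_λ(4[3]) = 1`,
`a_λ(3[4]) = 0` (the second conjunct of `DIP20_prop_3_15_table`).
[cite: DorflerIkenmeyerPanova2020, Prop. 3.15 (table row 2, arXiv p. 8; TeX multobs.tex L513 {pro:occobsdoexist})] -/
theorem DIP20_prop_3_15_table_row2 :
    plethysmCoeff ℂ (Fin 3) 3 (rowDual ![7, 3, 2]) = 1 ∧ plethysmCoeff ℂ (Fin 3) 4 (rowDual ![7, 3, 2]) = 0 :=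
  ⟨plethysmCoeff_rowDual_7_3_2_three, plethysmCoeff_rowDual_7_3_2_four⟩

/-- **Prop. 3.15, row 1, unconditionally**: `(2,2,2)` is an occurrence obstruction showing
`Pow_{3,3}^2 ⊄ Ch_3^2`: `mult_{(2,2,2)}(ℂ[Ch_3^2]_3) = 0 < mult_{(2,2,2)}(ℂ[Pow_{3,3}^2]_3)` (the Chow
side is the tree's `coordRingMultiplicity_chowSet_three_two_222`; the power-sum side is Prop. 3.3 and
`a_{(2,2,2)}(3[2]) = 1`). [cite: DorflerIkenmeyerPanova2020, Prop. 3.15 (row 1, arXiv pp. 7–8; TeX multobs.tex L513 {pro:occobsdoexist})] -/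
theorem DIP20_prop_3_15_row1 :
    coordRingMultiplicity ℂ (chowSet ℂ 3 2) 2 (rowDual ![2, 2, 2]) = 0 ∧
      0 < coordRingMultiplicity ℂ (powerSumSet ℂ 3 3 2) 2 (rowDual ![2, 2, 2]) := by
  refine ⟨coordRingMultiplicity_chowSet_three_two_222, ?_⟩
  rw [coordRingMultiplicity_powerSumSet_eq_plethysmCoeff (d := 3) (by norm_num) le_rfl
    (by rw [size_rowDual]; simp [Fin.sum_univ_succ]), plethysmCoeff_rowDual_2_2_2_two]
  exact Nat.one_pos

/-- **Prop. 3.15, row 2, unconditionally**: `(7,3,2)` is an occurrence obstruction showing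
`Pow_{3,4}^3 ⊄ Ch_3^3`: `mult_{(7,3,2)}(ℂ[Ch_3^3]_4) = 0 < mult_{(7,3,2)}(ℂ[Pow_{3,4}^3]_4)` (Chow side:
Lemma 3.4 and `a_{(7,3,2)}(3[4]) = 0`; power-sum side: Prop. 3.3 and `a_{(7,3,2)}(4[3]) = 1`).
[cite: DorflerIkenmeyerPanova2020, Prop. 3.15 (row 2, arXiv pp. 7–8; TeX multobs.tex L513 {pro:occobsdoexist})] -/
theorem DIP20_prop_3_15_row2 :
    coordRingMultiplicity ℂ (chowSet ℂ 3 3) 3 (rowDual ![7, 3, 2]) = 0 ∧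
      0 < coordRingMultiplicity ℂ (powerSumSet ℂ 3 4 3) 3 (rowDual ![7, 3, 2]) := by
  refine ⟨?_, ?_⟩
  · refine coordRingMultiplicity_chowSet_eq_zero_of_lem_3_4 DIP20_lem_3_4_holds le_rfl (by norm_num)
      [7, 3, 2] ?_ ?_ (by simp) (by simp) _ ?_ plethysmCoeff_rowDual_7_3_2_four
    · intro x hx; simp at hx; omega
    · simp
    · intro i; fin_cases i <;> rfl
  · rw [coordRingMultiplicity_powerSumSet_eq_plethysmCoeff (d := 4) (by norm_num) le_rfl
      (by rw [size_rowDual]; simp [Fin.sum_univ_succ]), plethysmCoeff_rowDual_7_3_2_three]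
    exact Nat.one_pos

/-- **Prop. 3.15 from the five entries of rows 3–5** (the certificate interface
`DIP20_prop_3_15_of_plethysm_bounds` with rows 1–2 fed by the values above): the positivity entries
`a_{(11,9,8)}(7[4]) > 0`, `a_{(12,9,9)}(6[5]) > 0`, `a_{(14,14,13,13)}(9[6]) > 0` and the vanishing entries
`a_{(11,9,8)}(4[7]) = 0`, `a_{(12,9,9)}(5[6]) = 0`, `a_{(14,14,13,13)}(6[9]) = 0` remain hypotheses.
[cite: DorflerIkenmeyerPanova2020, Prop. 3.15 (arXiv pp. 7–8; TeX multobs.tex L513 {pro:occobsdoexist})] -/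
theorem DIP20_prop_3_15_of_rows345
    (hpos : 0 < plethysmCoeff ℂ (Fin 3) 4 (rowDual ![11, 9, 8]) ∧
      0 < plethysmCoeff ℂ (Fin 3) 5 (rowDual ![12, 9, 9]) ∧
      0 < plethysmCoeff ℂ (Fin 4) 6 (rowDual ![14, 14, 13, 13]))
    (hvan : plethysmCoeff ℂ (Fin 3) 7 (rowDual ![11, 9, 8]) = 0 ∧
      plethysmCoeff ℂ (Fin 3) 6 (rowDual ![12, 9, 9]) = 0 ∧
      plethysmCoeff ℂ (Fin 4) 9 (rowDual ![14, 14, 13, 13]) = 0) : DIP20_prop_3_15 :=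
  DIP20_prop_3_15_of_plethysm_bounds
    ⟨by rw [plethysmCoeff_rowDual_2_2_2_two]; exact Nat.one_pos,
      by rw [plethysmCoeff_rowDual_7_3_2_three]; exact Nat.one_pos, hpos⟩
    ⟨plethysmCoeff_rowDual_7_3_2_four, hvan⟩

end Prop315Rows

/-! ### §V5. Degrees that cannot carry the weight -/

section DegreePinning

open MvPolynomial in
/-- **The weight pins the degree**: if `n ∤ |μ|` (in particular `n = 0 < |μ|`), then no form of any
degree has weight `μ^*` under `GL_N` acting on `ℂ[Sym^n ℂ^N]`, so `a_μ = plethysmCoeff n μ^* = 0` (DIP §2: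
the types occurring in `ℂ[𝔸_m^n]_d` are `m`-partitions of `dn`). A reusable form of the first step of the
tail computations of Lemmas 3.7 / 3.13 (every `n`, not only `n ∣ |μ|`).
[cite: DorflerIkenmeyerPanova2020, §2 (arXiv pp. 3–4) with Lemma 3.7 (p. 5)] -/
theorem plethysmCoeff_rowDual_eq_zero_of_not_dvd {N : ℕ} (μ : Fin N → ℕ) (n : ℕ)
    (h : ¬ n ∣ ∑ i, μ i) : plethysmCoeff ℂ (Fin N) n (rowDual μ) = 0 := by
  classical
  rw [plethysmCoeff, hwMultiplicity]
  suffices H : highestWeightSpace (coordRep (Fin N) ℂ n) (rowDual μ) = ⊥ by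
    rw [H, finrank_bot]
  rw [Submodule.eq_bot_iff]
  intro f hf
  by_contra hne
  obtain ⟨s, hsup⟩ := support_nonempty.mpr hne
  have hw := monWeight_eq_of_mem_weightSpace (highestWeightSpace_le_weightSpace _ _ hf) hsup
  have hsize1 := size_monWeight s
  rw [hw, size_rowDual, neg_inj, Nat.cast_inj] at hsize1
  exact h ⟨s.degree, hsize1⟩

/-- In particular `a_μ` vanishes in inner degree `0` for every nonzero `μ`. [cite: DorflerIkenmeyerPanova2020, §2 (arXiv pp. 3–4)] -/
theorem plethysmCoeff_rowDual_zero_eq_zero {N : ℕ} (μ : Fin N → ℕ) (h : 0 < ∑ i, μ i) :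
    plethysmCoeff ℂ (Fin N) 0 (rowDual μ) = 0 :=
  plethysmCoeff_rowDual_eq_zero_of_not_dvd μ 0 (by rw [Nat.zero_dvd]; omega)

end DegreePinning

end Literature.Computability.AlgebraicComplexity
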